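import Mathlib
import Summits.ValiantsHypothesis.ValiantsHypothesis.Theorems.FifoMatchingNNMonotoneHardMeasure
import Summits.ValiantsHypothesis.ValiantsHypothesis.Theorems.FifoMatchingNNMonotoneHardReduction
import HarnessLib

/-!
# Crux `NNMonotoneHard` (stmt-ValiantsHypothesis-11617): the nest-free matching polynomials are
# not p-computable over `ℝ≥0` — PROOF

Assembly (piece (F) of `Cruxes/NNMonotoneHard/PROOF-PLAN.md`): choose the parameters of the
thick-queue measure as polynomials in one integer `r` (`m = 48 r³`, `L = 2mr + 3m`,
`K = 2L + 4m + 2`, `J = 6r + 4`, `N = JK + 2`, `2n = 2L + N`), check the side conditions of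
`exists_thick_measure`, and let `r → ∞`: every balanced split is respected with mass
`≤ 2N (3/4)^r`, which beats any polynomial in `n = O(r⁵)`.  Feeding
`nnMonotoneHard_of_spread_measures` (the landed reduction: homogeneous structure theorem +
balanced products live on one vertex split) proves the registered stub `stub_spreadMeasures` and
the crux `NNMonotoneHard`: monotone arithmetic circuits for `NN_n` have superpolynomial size
(`L₊(NN_n) ≥ 2^{Ω(n^{1/5})}` is what the argument gives; only "not p-bounded" is recorded).

Honest framing: a monotone lower bound for the route's candidate family — the route's
consistency check / kill switch, NOT a step towards `NN ∉ VP`; VP ≠ VNP is not moved by this file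
(monotone ≠ general, `Literature.Barriers.ValiantsHypothesis.MonotoneGap`).  No definitions, no
named facts.
-/

noncomputable section

-- Sub = Summit single-conjunct layout: the duplicated namespace component is mandated by the tree.
set_option linter.dupNamespace false

namespace Summit.ValiantsHypothesis.ValiantsHypothesis.Theorems.FifoMatching.NNMonotoneHard

open Finset Filter Literature.Computability.AlgebraicComplexity
open scoped NNReal Topology

/-- `C · r^d · a^r < ε` eventually, for `0 ≤ a < 1`. [folklore] -/
theorem eventually_const_mul_pow_mul_pow_lt (d : ℕ) {a C ε : ℝ} (ha0 : 0 ≤ a) (ha1 : a < 1)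
    (hε : 0 < ε) :
    ∀ᶠ r : ℕ in atTop, C * (r : ℝ) ^ d * a ^ r < ε := by
  have h := tendsto_pow_const_mul_const_pow_of_abs_lt_one d (r := a)
    (by rw [abs_lt]; constructor <;> linarith)
  have h2 : Tendsto (fun r : ℕ => C * ((r : ℝ) ^ d * a ^ r)) atTop (𝓝 0) := by
    simpa using h.const_mul C
  have h3 := h2.eventually_lt_const hε
  filter_upwards [h3] with r hr
  simpa [mul_assoc] using hr

/-- **The registered stub `stub_spreadMeasures` of line `thick-queue`**: for every exponent `c`
there are `n ≥ 3` and a probability weighting of the nest-free perfect matchings of `[2n]` under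
which every balanced vertex split is respected with mass `< 1 / (4 (n^c + c) (n + 1)²)`.
[folklore] -/
theorem stub_spreadMeasures :
    ∀ c : ℕ, ∃ n : ℕ, 3 ≤ n ∧ ∃ μ : (Fin (2 * n) → Fin (2 * n)) → ℝ≥0,
      (∑ M ∈ nestFreeMatchings (2 * n), μ M = 1) ∧
      ∀ S : Finset (Fin (2 * n)), 2 * n < 3 * S.card → 3 * S.card ≤ 4 * n →
        ((4 * (n ^ c + c) * (n + 1) ^ 2 : ℕ) : ℝ≥0) *
          (∑ M ∈ (nestFreeMatchings (2 * n)).filter (fun M => ∀ i, i ∈ S ↔ M i ∈ S), μ M) < 1 := by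
  intro c
  -- the two asymptotic requirements, in the variable `r`
  have hexp0 : 0 ≤ Real.exp (-(1 / 6 : ℝ)) := (Real.exp_pos _).le
  have hexp1 : Real.exp (-(1 / 6 : ℝ)) < 1 := Real.exp_lt_one_iff.2 (by norm_num)
  have E1 := eventually_const_mul_pow_mul_pow_lt 10 (C := 4 * 6742 ^ 2) hexp0 hexp1 one_pos
  have E2 := eventually_const_mul_pow_mul_pow_lt (5 * c + 15)
    (C := 4 * ((3611 : ℝ) ^ c + c) * (4 * 3611 ^ 2) * (2 * 6742)) (a := 3 / 4)
    (by norm_num) (by norm_num) one_pos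
  obtain ⟨r, hr1', hE1, hE2⟩ := ((eventually_ge_atTop 1).and (E1.and E2)).exists
  -- the parameters
  set m : ℕ := 48 * r ^ 3 with hm
  set L : ℕ := 2 * m * r + 3 * m with hL
  set K₂ : ℕ := L + 2 * m + 1 with hK₂
  set K : ℕ := 2 * K₂ with hK
  set J : ℕ := 6 * r + 4 with hJ
  set N : ℕ := 2 * (J * K₂ + 1) with hN
  set n : ℕ := L + J * K₂ + 1 with hn
  -- crude size bounds (`r ≥ 1`)
  have hr1 : 1 ≤ r := hr1'
  have hr3 : r ≤ r ^ 3 := by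
    calc r = r ^ 1 := (pow_one r).symm
      _ ≤ r ^ 3 := Nat.pow_le_pow_right hr1 (by norm_num)
  have hr34 : r ^ 3 ≤ r ^ 4 := Nat.pow_le_pow_right hr1 (by norm_num)
  have hr45 : r ^ 4 ≤ r ^ 5 := Nat.pow_le_pow_right hr1 (by norm_num)
  have hr4 : r ^ 4 = r ^ 3 * r := by ring
  have hr5 : r ^ 5 = r ^ 4 * r := by ring
  have hr14 : 1 ≤ r ^ 4 := Nat.one_le_pow _ _ hr1
  have hr15 : 1 ≤ r ^ 5 := Nat.one_le_pow _ _ hr1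
  have hLle : L ≤ 240 * r ^ 4 := by
    rw [hL, hm]
    have : 2 * (48 * r ^ 3) * r + 3 * (48 * r ^ 3) = 96 * r ^ 4 + 144 * r ^ 3 := by ring
    rw [this]; omega
  have hK₂le : K₂ ≤ 337 * r ^ 4 := by rw [hK₂, hm]; omega
  have hJle : J ≤ 10 * r := by rw [hJ]; omega
  have hJK₂ : J * K₂ ≤ 3370 * r ^ 5 := by
    calc J * K₂ ≤ (10 * r) * (337 * r ^ 4) := Nat.mul_le_mul hJle hK₂le
      _ = 3370 * r ^ 5 := by ring
  have hNle : N ≤ 6742 * r ^ 5 := by rw [hN]; omega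
  have hnle : n ≤ 3611 * r ^ 5 := by rw [hn]; omega
  have hm1 : 1 ≤ m := by
    rw [hm]; have := Nat.one_le_pow 3 r hr1; omega
  have hn3 : 3 ≤ n := by rw [hn, hL]; omega
  -- side conditions of the measure theorem
  have hM : L + N + L = 2 * n := by rw [hN, hn]; ring
  have hmL : m ≤ L := by rw [hL]; omega
  have hKe : 2 * L + 4 * m + 2 ≤ K := by rw [hK, hK₂]; omega
  have hJK : J * K + 1 ≤ N := by
    rw [hN, hK]
    have : J * (2 * K₂) = 2 * (J * K₂) := by ring
    omega
  have hr1J : 4 * r ≤ J := by rw [hJ]; omega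
  have hr3L : 2 * m * r + 3 * m ≤ L := by rw [hL]
  have hreg : 3 * (2 * K * r + (2 * n - J * K)) ≤ 2 * n := by
    have h2n : 2 * n = J * K + (2 * L + 2) := by rw [hn, hK]; ring
    rw [h2n, Nat.add_sub_cancel_left]
    have e1 : J * K = 6 * (K * r) + 4 * K := by rw [hJ]; ring
    have e2 : K = 2 * L + 4 * m + 2 := by rw [hK, hK₂]; ring
    have e3 : 2 * K * r = 2 * (K * r) := by ring
    rw [e1, e3]
    omega
  have hNpos : 0 < N := by rw [hN]; omega
  -- the band estimate `2N e^{-m²/(2N)} 2^N ≤ 2^N/(2N)`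
  have hNr : (0 : ℝ) < N := by exact_mod_cast hNpos
  have hband : 2 * (N : ℝ) * Real.exp (-((m : ℝ) ^ 2 / (2 * N))) * 2 ^ N ≤ 2 ^ N / (2 * N) := by
    -- `m²/(2N) ≥ r/6`
    have h1 : (r : ℝ) / 6 ≤ (m : ℝ) ^ 2 / (2 * N) := by
      rw [div_le_div_iff₀ (by norm_num) (mul_pos (by norm_num) hNr)]
      have : (r : ℝ) * (2 * N) ≤ (m : ℝ) ^ 2 * 6 := by
        have hnat : r * (2 * N) ≤ m ^ 2 * 6 := by
          calc r * (2 * N) ≤ r * (2 * (6742 * r ^ 5)) := by gcongr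
            _ = 13484 * r ^ 6 := by ring
            _ ≤ 13824 * r ^ 6 := Nat.mul_le_mul_right _ (by norm_num)
            _ = (48 * r ^ 3) ^ 2 * 6 := by ring
            _ = m ^ 2 * 6 := by rw [hm]
        exact_mod_cast hnat
      linarith
    have h2 : Real.exp (-((m : ℝ) ^ 2 / (2 * N))) ≤ Real.exp (-(1 / 6 : ℝ)) ^ r := by
      rw [← Real.exp_nat_mul, Real.exp_le_exp]
      have : (r : ℝ) * -(1 / 6 : ℝ) = -((r : ℝ) / 6) := by ring
      rw [this]
      linarith
    have h3 : 4 * (N : ℝ) ^ 2 * Real.exp (-((m : ℝ) ^ 2 / (2 * N))) ≤ 1 := by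
      have hN5 : (N : ℝ) ≤ 6742 * (r : ℝ) ^ 5 := by exact_mod_cast hNle
      calc 4 * (N : ℝ) ^ 2 * Real.exp (-((m : ℝ) ^ 2 / (2 * N)))
          ≤ 4 * (6742 * (r : ℝ) ^ 5) ^ 2 * Real.exp (-(1 / 6 : ℝ)) ^ r := by
            gcongr
        _ = 4 * 6742 ^ 2 * (r : ℝ) ^ 10 * Real.exp (-(1 / 6 : ℝ)) ^ r := by ring
        _ ≤ 1 := hE1.le
    -- rearrange
    have hN0 : (N : ℝ) ≠ 0 := hNr.ne'
    rw [show 2 * (N : ℝ) * Real.exp (-((m : ℝ) ^ 2 / (2 * N))) * 2 ^ N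
        = (4 * (N : ℝ) ^ 2 * Real.exp (-((m : ℝ) ^ 2 / (2 * N)))) * (2 ^ N / (2 * N)) by
      field_simp; ring]
    calc (4 * (N : ℝ) ^ 2 * Real.exp (-((m : ℝ) ^ 2 / (2 * N)))) * (2 ^ N / (2 * N))
        ≤ 1 * (2 ^ N / (2 * N)) := by gcongr
      _ = 2 ^ N / (2 * N) := one_mul _
  obtain ⟨μ, hμ1, hμS⟩ := exists_thick_measure hM hmL hm1 hKe hJK hr1J hr3L hreg hNpos hband
  refine ⟨n, hn3, μ, hμ1, fun S hS1 hS2 => ?_⟩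
  have hmass := hμS S hS1 hS2
  -- the final inequality: `4 (n^c + c) (n+1)² · 2N (3/4)^r < 1`
  have hfin : (4 * ((n : ℝ) ^ c + c) * ((n : ℝ) + 1) ^ 2) * ((2 * (N : ℝ)) * (3 / 4 : ℝ) ^ r) < 1 := by
    have hn5 : (n : ℝ) ≤ 3611 * (r : ℝ) ^ 5 := by exact_mod_cast hnle
    have hN5 : (N : ℝ) ≤ 6742 * (r : ℝ) ^ 5 := by exact_mod_cast hNle
    have hr1r : (1 : ℝ) ≤ r := by exact_mod_cast hr1
    have hn1 : (1 : ℝ) ≤ n := by exact_mod_cast (by omega : 1 ≤ n)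
    have hr5pos : (1 : ℝ) ≤ (r : ℝ) ^ 5 := one_le_pow₀ hr1r
    -- `n^c + c ≤ (3611^c + c) r^{5c}` and `(n+1)^2 ≤ 4 · 3611² r^{10}`
    have hA : ((n : ℝ) ^ c + c) ≤ ((3611 : ℝ) ^ c + c) * (r : ℝ) ^ (5 * c) := by
      have h1 : (n : ℝ) ^ c ≤ (3611 * (r : ℝ) ^ 5) ^ c := by gcongr
      rw [mul_pow, ← pow_mul] at h1
      have h2 : (c : ℝ) ≤ c * (r : ℝ) ^ (5 * c) := by
        have : (1 : ℝ) ≤ (r : ℝ) ^ (5 * c) := one_le_pow₀ hr1r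
        nlinarith
      nlinarith
    have hB : ((n : ℝ) + 1) ^ 2 ≤ 4 * 3611 ^ 2 * (r : ℝ) ^ 10 := by
      have h1 : (n : ℝ) + 1 ≤ 2 * (3611 * (r : ℝ) ^ 5) := by nlinarith
      have h2 : ((n : ℝ) + 1) ^ 2 ≤ (2 * (3611 * (r : ℝ) ^ 5)) ^ 2 := by gcongr
      calc ((n : ℝ) + 1) ^ 2 ≤ (2 * (3611 * (r : ℝ) ^ 5)) ^ 2 := h2
        _ = 4 * 3611 ^ 2 * (r : ℝ) ^ 10 := by ring
    have hC : (2 * (N : ℝ)) ≤ 2 * 6742 * (r : ℝ) ^ 5 := by linarith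
    have hX : 4 * ((n : ℝ) ^ c + c) * ((n : ℝ) + 1) ^ 2
        ≤ 4 * (((3611 : ℝ) ^ c + c) * (r : ℝ) ^ (5 * c)) * (4 * 3611 ^ 2 * (r : ℝ) ^ 10) := by
      have h0 : (0 : ℝ) ≤ (n : ℝ) ^ c + c := by positivity
      exact mul_le_mul (mul_le_mul_of_nonneg_left hA (by norm_num)) hB (by positivity)
        (by positivity)
    have hY : (2 * (N : ℝ)) * (3 / 4 : ℝ) ^ r ≤ (2 * 6742 * (r : ℝ) ^ 5) * (3 / 4 : ℝ) ^ r :=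
      mul_le_mul_of_nonneg_right hC (by positivity)
    calc (4 * ((n : ℝ) ^ c + c) * ((n : ℝ) + 1) ^ 2) * ((2 * (N : ℝ)) * (3 / 4 : ℝ) ^ r)
        ≤ (4 * (((3611 : ℝ) ^ c + c) * (r : ℝ) ^ (5 * c)) * (4 * 3611 ^ 2 * (r : ℝ) ^ 10))
            * ((2 * 6742 * (r : ℝ) ^ 5) * (3 / 4 : ℝ) ^ r) :=
          mul_le_mul hX hY (by positivity) (by positivity)
      _ = 4 * ((3611 : ℝ) ^ c + c) * (4 * 3611 ^ 2) * (2 * 6742)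
            * (r : ℝ) ^ (5 * c + 15) * (3 / 4 : ℝ) ^ r := by ring
      _ < 1 := hE2
  -- transfer to `ℝ≥0`
  have hmass' : ((4 * (n ^ c + c) * (n + 1) ^ 2 : ℕ) : ℝ≥0) *
      (∑ M ∈ (nestFreeMatchings (2 * n)).filter (fun M => ∀ i, i ∈ S ↔ M i ∈ S), μ M)
      ≤ ((4 * (n ^ c + c) * (n + 1) ^ 2 : ℕ) : ℝ≥0) * ((2 * N : ℝ≥0) * ((3 : ℝ≥0) / 4) ^ r) :=
    mul_le_mul_of_nonneg_left hmass zero_le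
  refine lt_of_le_of_lt hmass' ?_
  rw [← NNReal.coe_lt_coe]
  push_cast
  linarith [hfin]

/-- **`NNMonotoneHard` (crux of route `FifoMatching`, item stmt-ValiantsHypothesis-11617).**
The nest-free (FIFO / queue) matching polynomials `NN_n` are not p-computable over the semiring
`ℝ≥0`: monotone arithmetic circuits for `NN_n` have superpolynomial size.  Proof: the thick-queue
measure (`stub_spreadMeasures`) fed into the reduction `nnMonotoneHard_of_spread_measures`.
[folklore] -/
theorem nnMonotoneHard_proof :
    Summit.ValiantsHypothesis.ValiantsHypothesis.Theses.FifoMatching.NNMonotoneHard :=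
  nnMonotoneHard_of_spread_measures stub_spreadMeasures

end Summit.ValiantsHypothesis.ValiantsHypothesis.Theorems.FifoMatching.NNMonotoneHard
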